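import Mathlib
import Summits.KontsevichZagierPeriods.KontsevichZagierPeriods.Theses.LinRedNormalForm

/-!
# Sketch — first lemmas of the crux ideas for `ArrangementNormalForm` (stmt-KontsevichZagierPeriods-3915)

Cards: `tame-cross-scissors` (first lemma `PlanarCrossNormalForm`) and
`feynman-transpose-duality` (first lemma `FeynmanDuality`). Statements only (no proofs required at
crux-ideate stage); everything is stated over existing declarations of
`Literature.NumberTheory.Transcendental.KZCalculus` and the route file.
-/

namespace Summit.KontsevichZagierPeriods.KontsevichZagierPeriods.Cruxes.ArrangementNormalForm.Sketch

open Literature.NumberTheory.Transcendental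
open scoped BigOperators

/-- The ℤ-span of hyperlogarithm WORD representations with rational letters — literally the set in the
conclusion of the crux `ArrangementNormalForm`. -/
def wordSpan : AddSubgroup KZ.FormalRep :=
  AddSubgroup.closure {y : KZ.FormalRep | ∃ (w : ℕ) (a : Fin w → ℚ) (q : ℚ) (s : KZ.IntegralRep w),
    s.domain = {t | (∀ i, 0 < t i) ∧ (∀ i, t i < 1) ∧ StrictAnti t} ∧
    Set.EqOn s.integrand (fun t => (q : ℝ) * ∏ i, 1 / (t i - (a i : ℝ))) s.domain ∧ y = KZ.of s}

/-- **Card A, first lemma (`PlanarCrossNormalForm`).** The `n = 2` logarithmic core of the crux: an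
absolutely convergent representation whose domain is an open rational triangle (three affine
inequalities) and whose integrand is the coordinate-cross form `1/(x₀ x₁)` is KZ-equivalent to a
ℤ-combination of word representations. (Instance of `ArrangementNormalForm` with `n = 2`, `m' = 3`,
`L` = the two coordinate forms, `e = 1`, `p = 1`; claimed provable now by planar dissection into
axis-legged right triangles, see the card.) -/
def PlanarCrossNormalForm : Prop :=
  ∀ (r : KZ.IntegralRep 2) (M : Fin 3 → (Fin 2 → ℚ) × ℚ),
    r.domain = {x | ∀ j, 0 < ∑ i, ((M j).1 i : ℝ) * x i + ((M j).2 : ℝ)} →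
    Set.EqOn r.integrand (fun x => 1 / (x 0 * x 1)) r.domain →
    ∃ c ∈ wordSpan, KZ.of r - c ∈ KZ.relations

/-- **Card A, general-dimension form of the same-dimension scissors target (`CrossScissors`).** Every
absolutely convergent representation on an open rational polyhedral cell with the coordinate-cross
integrand `1/∏ xᵢ` is KZ-equivalent to a ℤ-combination of word representations. (The log core of the
crux after the change of variables `u = L(x)`; equivalent to the crux's log core by one affine move.) -/
def CrossScissors : Prop :=
  ∀ (n m' : ℕ) (r : KZ.IntegralRep n) (M : Fin m' → (Fin n → ℚ) × ℚ),
    r.domain = {x | ∀ j, 0 < ∑ i, ((M j).1 i : ℝ) * x i + ((M j).2 : ℝ)} →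
    Set.EqOn r.integrand (fun x => 1 / ∏ i, x i) r.domain →
    ∃ c ∈ wordSpan, KZ.of r - c ∈ KZ.relations

/-- **Card B, first lemma (`FeynmanDuality`).** Feynman TRANSPOSE duality inside the KZ calculus: for a
nonnegative rational `(n+1) × (n+1)` matrix `V` with no zero row and no zero column, the representation
on the open corner simplex `Dₙ = {x | xᵢ > 0, ∑ xᵢ < 1}` with integrand `1/∏ⱼ (Vᵀ λ̄)ⱼ`
(`λ̄ = (1 − ∑ xᵢ, x₁, …, xₙ)` barycentric) is KZ-equivalent to the one with integrand `1/∏ₖ (V ū)ₖ`.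
Value level: Feynman parametrisation + `∫_S dy/ℓ(y)^{n+1} = vol S/∏ₖ ℓ(wₖ)`; move level: Newton–Leibniz
with RATIONAL primitives only, all intermediates positive. -/
def FeynmanDuality : Prop :=
  ∀ (n : ℕ) (V : Fin (n + 1) → Fin (n + 1) → ℚ) (r r' : KZ.IntegralRep n),
    (∀ k j, 0 ≤ V k j) → (∀ k, ∃ j, 0 < V k j) → (∀ j, ∃ k, 0 < V k j) →
    r.domain = {x | (∀ i, 0 < x i) ∧ ∑ i, x i < 1} →
    Set.EqOn r.integrand
      (fun x => 1 / ∏ j : Fin (n + 1),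
        ((V 0 j : ℝ) * (1 - ∑ i, x i) + ∑ i : Fin n, (V i.succ j : ℝ) * x i)) r.domain →
    r'.domain = {u | (∀ i, 0 < u i) ∧ ∑ i, u i < 1} →
    Set.EqOn r'.integrand
      (fun u => 1 / ∏ k : Fin (n + 1),
        ((V k 0 : ℝ) * (1 - ∑ j, u j) + ∑ j : Fin n, (V k j.succ : ℝ) * u j)) r'.domain →
    KZ.Equivalent r r'

/-- **Card B, the lever it buys (`TamePolarSubdivision`, informal shape).** Dual of domain additivity:
for nonnegative `V` and any matrix `B` with nonnegative rational entries whose columns `b₀,…,bₙ` are the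
barycentric coordinates of the vertices of ONE simplex of a rational triangulation of the standard
simplex, the "polar-subdivided" representation with integrand `1/∏ⱼ ((V B)ᵀ λ̄)ⱼ` is a legal summand:
`[Dₙ, 1/∏ⱼ (Vᵀλ̄)ⱼ] ≡ ∑_pieces |det B| · [Dₙ, 1/∏ⱼ ((V B)ᵀ λ̄)ⱼ]`. Stated here for a single
two-piece subdivision (bisection of the dual simplex through the midpoint of the edge `e₀e₁`), the
smallest instance. -/
def TamePolarBisection : Prop :=
  ∀ (n : ℕ) (V : Fin (n + 2) → Fin (n + 2) → ℚ) (r r₁ r₂ : KZ.IntegralRep (n + 1)),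
    (∀ k j, 0 ≤ V k j) → (∀ k, ∃ j, 0 < V k j) → (∀ j, ∃ k, 0 < V k j) →
    r.domain = {x | (∀ i, 0 < x i) ∧ ∑ i, x i < 1} →
    r₁.domain = r.domain → r₂.domain = r.domain →
    Set.EqOn r.integrand
      (fun x => 1 / ∏ j : Fin (n + 2),
        ((V 0 j : ℝ) * (1 - ∑ i, x i) + ∑ i : Fin (n + 1), (V i.succ j : ℝ) * x i)) r.domain →
    -- piece 1: polar 0 replaced by (polar 0 + polar 1)/2
    Set.EqOn r₁.integrand
      (fun x => (1 / 2 : ℝ) / ∏ j : Fin (n + 2),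
        (((if j = 0 then (V 0 0 + V 0 1) / 2 else V 0 j : ℚ) : ℝ) * (1 - ∑ i, x i) +
          ∑ i : Fin (n + 1), ((if j = 0 then (V i.succ 0 + V i.succ 1) / 2 else V i.succ j : ℚ) : ℝ) * x i))
      r₁.domain →
    -- piece 2: polar 1 replaced by (polar 0 + polar 1)/2
    Set.EqOn r₂.integrand
      (fun x => (1 / 2 : ℝ) / ∏ j : Fin (n + 2),
        (((if j = 1 then (V 0 0 + V 0 1) / 2 else V 0 j : ℚ) : ℝ) * (1 - ∑ i, x i) +
          ∑ i : Fin (n + 1), ((if j = 1 then (V i.succ 0 + V i.succ 1) / 2 else V i.succ j : ℚ) : ℝ) * x i))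
      r₂.domain →
    KZ.of r - KZ.of r₁ - KZ.of r₂ ∈ KZ.relations

/-- Sanity: the word span here is literally the set appearing in the crux. -/
example : (∃ c ∈ wordSpan, (0 : KZ.FormalRep) - c ∈ KZ.relations) := ⟨0, zero_mem _, by simp⟩

/-- The crux implies Card A's first lemma would be the natural sanity implication; we only record that
both elaborate against the route decl. -/
example : Summit.KontsevichZagierPeriods.KontsevichZagierPeriods.Theses.LinRedNormalForm.ArrangementNormalForm →
    True := fun _ => trivial

end Summit.KontsevichZagierPeriods.KontsevichZagierPeriods.Cruxes.ArrangementNormalForm.Sketch
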